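import Summits.HubbardSuperconductivity.HubbardSuperconductivity.Theses.LevyLogBootstrap
import HarnessLib

/-!
# Route `LevyLogBootstrap`, support `LevyJensenFloor` (stmt-HubbardSuperconductivity-15050)

The ν-free "take logarithms" floor (card `levy-mass-log-bootstrap`, P1): for every `M` and every
entrywise positive function `k` on the torus `(ℤ/Mℤ)²`,
`exp(−M⁻² Σ_X log(k(0)/k(X))) ≤ (Σ_X k(X)) / (M² k(0))` — "condensate fraction ≥ e^{−Lévy mass}".
Proof: Jensen's inequality for the convex function `exp` with the uniform weights `1/M²` on the
`M²` points of the torus (`ConvexOn.map_sum_le`, `convexOn_exp`), since `exp(log(k X / k 0)) = k X / k 0`.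
Berg–Christensen–Ressel (1984) Ch. 3; Bhatia (2006). No definition is introduced; sorry-free.
-/

noncomputable section

set_option linter.dupNamespace false

namespace Summit.HubbardSuperconductivity.HubbardSuperconductivity.Theorems.LevyLogBootstrap

open scoped BigOperators
open Finset Literature.Probability.LatticeModels
open Summit.HubbardSuperconductivity.HubbardSuperconductivity.Theses.LevyLogBootstrap

/-- **`LevyJensenFloor` holds** (item stmt-HubbardSuperconductivity-15050): for every `M` and every
entrywise positive `k : (ℤ/Mℤ)² → ℝ`, `exp(−M⁻² Σ_X log(k 0 / k X)) ≤ (Σ_X k X) / (M² · k 0)` —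
Jensen for `exp` with uniform weights. [cite: BergChristensenRessel1984, Ch. 3] -/
theorem levyJensenFloor_proof : LevyJensenFloor := by
  intro M _ k hk
  have hcard : (Fintype.card (TorusSite 2 M) : ℝ) = (M : ℝ) ^ 2 := by
    change (Fintype.card (Fin 2 → ZMod M) : ℝ) = (M : ℝ) ^ 2
    rw [Fintype.card_fun, ZMod.card, Fintype.card_fin]
    push_cast
    ring
  have hM : (0 : ℝ) < (M : ℝ) ^ 2 := by
    have : (0 : ℝ) < (M : ℝ) := by exact_mod_cast Nat.pos_of_ne_zero (NeZero.ne M)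
    positivity
  have hk0 : 0 < k 0 := hk 0
  -- Jensen for `exp`, uniform weights `1/M²`, points `log (k X / k 0)`
  have hJ := (convexOn_exp).map_sum_le (t := (Finset.univ : Finset (TorusSite 2 M)))
    (w := fun _ => 1 / (M : ℝ) ^ 2) (p := fun X => Real.log (k X / k 0))
    (fun _ _ => by positivity)
    (by rw [Finset.sum_const, Finset.card_univ, nsmul_eq_mul, hcard, mul_one_div_cancel hM.ne'])
    (fun _ _ => Set.mem_univ _)
  -- rewrite both sides
  have h1 : ∑ X, Real.log (k X / k 0) = -(∑ X, Real.log (k 0 / k X)) := by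
    rw [← Finset.sum_neg_distrib]
    refine Finset.sum_congr rfl fun X _ => ?_
    rw [Real.log_div (hk X).ne' hk0.ne', Real.log_div hk0.ne' (hk X).ne']
    ring
  have h2 : ∑ X, Real.exp (Real.log (k X / k 0)) = (∑ X, k X) / k 0 := by
    rw [Finset.sum_div]
    refine Finset.sum_congr rfl fun X _ => ?_
    rw [Real.exp_log (div_pos (hk X) hk0)]
  have hlhs : ∑ X, (1 / (M : ℝ) ^ 2) • Real.log (k X / k 0) =
      -(∑ X, Real.log (k 0 / k X)) / (M : ℝ) ^ 2 := by
    rw [← Finset.smul_sum, smul_eq_mul, h1]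
    ring
  have hrhs : ∑ X, (1 / (M : ℝ) ^ 2) • Real.exp (Real.log (k X / k 0)) =
      (∑ X, k X) / ((M : ℝ) ^ 2 * k 0) := by
    rw [← Finset.smul_sum, smul_eq_mul, h2, one_div, ← div_eq_inv_mul, div_div, mul_comm (k 0)]
  rw [hlhs, hrhs] at hJ
  exact hJ

end Summit.HubbardSuperconductivity.HubbardSuperconductivity.Theorems.LevyLogBootstrap

end
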